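import Mathlib.Probability.Independence.Basic
import Summits.AtomisticToContinuum.HydrodynamicLimit.Theorems.TwoClocksEquilibriumShearWindowLDGauss
import Literature.MathematicalPhysics.KineticTheory.HardSphereEulerProofs
import HarnessLib

/-!
# Crux `FluxClosure` (stmt-AtomisticToContinuum-9902, route BoxDissipativeWeakStrong), line `registered`:
# one-site Gaussian exponential moments (sub-goal Ga of the entropy line for the kinetic stub K)

Support file (`--supports stmt-AtomisticToContinuum-9902`) for the crux
`Summit.AtomisticToContinuum.HydrodynamicLimit.Theses.BoxDissipativeWeakStrong.FluxClosure`: the registered sub-goal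
Ga `gauss_lintegral_exp_quad_le`. The entropy line for stub K (relative-entropy local equilibrium ⇒ kinetic
isotropy of the box velocity covariances) needs a speed-`(N+1)` exponential moment of the box kinetic-stress
functional under local Gibbs laws; given the positions it factorises into ONE-SITE exponential moments of the
Maxwellian `N(u, θ𝟙) = gaussMeasure u θ` (the image of the standard Gaussian `γ` of `ℝ³` under `w ↦ u + √θ w`).
This file computes them (all are exact Gaussian integrals) in the `∫⁻ … ENNReal.ofReal (Real.exp …)` currency:

* linear: `∫ exp(s (v_k - u_k)) N(u, θ𝟙)(dv) = exp(θ s²/2)` (the coordinate `w_k` of `γ` is `N(0,1)`; its mgf in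
  `lintegral` form is the landed `Theorems.lintegral_exp_mul_gaussianReal` of
  `TwoClocksEquilibriumShearWindowLDGauss`, reused);
* centred diagonal quadratic: for `|s| θ ≤ 1/4`, with `a = sθ`,
  `∫ exp(s ((v_i - u_i)² - θ)) dN(u, θ𝟙) = e^{-a} ∫ exp(a w_i²) dγ = e^{-a} (1 - 2a)^{-1/2} ≤ exp(4a²)`
  (the `χ²` moment `∫ exp(c x²) N(0,1)(dx) = (1 - 2c)^{-1/2}`, `c < 1/2`, is the landed
  `Theorems.lintegral_exp_mul_sq_gaussianReal`, reused; the final inequality is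
  `(1 - 2a)(1 + 2a + 8a²) = 1 + 4a²(1 - 4a) ≥ 1` and `1 + y ≤ eʸ`);
* off-diagonal quadratic, `i ≠ j`: the pair `(w_i, w_j)` of coordinates of `γ` is a pair of INDEPENDENT standard
  normals (`γ` is the image of `⊗₃ N(0,1)` under `toLp`, Mathlib's `map_pi_eq_stdGaussian`, and the coordinates of a
  product measure are independent, `iIndepFun_pi`), so by Tonelli and the two one-dimensional formulas
  `∫ exp(a w_i w_j) dγ = ∫ exp(a² x²/2) N(0,1)(dx) = (1 - a²)^{-1/2} ≤ exp(4a²)` (`(1 - a²)(1 + 8a²) ≥ 1` for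
  `a² ≤ 7/8`).

No definitions, no new facts: Mathlib (`gaussianReal`, `stdGaussian`, independence of the coordinates of
`Measure.pi`), the two one-dimensional moments of `TwoClocksEquilibriumShearWindowLDGauss` (whose
`lintegral_exp_mul_coord_mul_coord_stdGaussian` is the pair `(0, 1)` of the off-diagonal case; here all pairs are
needed) and the `gaussMeasure` prelude of `HardSphereEulerProofs` only. References: standard
(Gaussian and `χ²` moment generating functions, e.g. A. Gut, *An Intermediate Course in Probability* (2009), Ch. III);
H. Spohn, *Large Scale Dynamics of Interacting Particles* (1991), Part I §2.3 (local Maxwellians).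
-/

noncomputable section

namespace Summit.AtomisticToContinuum.HydrodynamicLimit.Theorems
namespace FluxClosureEnt

open scoped BigOperators Topology Classical MeasureTheory ProbabilityTheory InnerProductSpace ENNReal
open Filter Set Function MeasureTheory ProbabilityTheory
open Literature.MathematicalPhysics.KineticTheory Literature.Analysis.FluidPDE

/-! ### Two elementary exponential inequalities -/

/-- If `0 < y` and `1 ≤ y e^{2b}` then `y^{-1/2} ≤ eᵇ`. -/
theorem entGa_inv_sqrt_le_exp {y b : ℝ} (hy : 0 < y) (h : 1 ≤ y * Real.exp (2 * b)) :
    (Real.sqrt y)⁻¹ ≤ Real.exp b := by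
  rw [inv_le_iff_one_le_mul₀' (Real.sqrt_pos.2 hy)]
  have h2 : Real.sqrt y * Real.exp b = Real.sqrt (y * Real.exp (2 * b)) := by
    rw [Real.sqrt_mul hy.le, show (2 : ℝ) * b = b + b by ring, Real.exp_add,
      Real.sqrt_mul_self (Real.exp_pos _).le]
  rw [h2, Real.one_le_sqrt]
  exact h

/-- Diagonal constant: for `|a| ≤ 1/4`, `e^{-a} (1 - 2a)^{-1/2} ≤ exp(4a²)`
(`(1 - 2a)(1 + 2a + 8a²) = 1 + 4a²(1 - 4a) ≥ 1` and `1 + y ≤ eʸ`). -/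
theorem entGa_exp_neg_mul_inv_sqrt_le {a : ℝ} (ha : |a| ≤ 1 / 4) :
    Real.exp (-a) * (Real.sqrt (1 - 2 * a))⁻¹ ≤ Real.exp (4 * a ^ 2) := by
  obtain ⟨ha1, ha2⟩ := abs_le.1 ha
  have hy : 0 < 1 - 2 * a := by linarith
  have h1 : (Real.sqrt (1 - 2 * a))⁻¹ ≤ Real.exp (4 * a ^ 2 + a) := by
    refine entGa_inv_sqrt_le_exp hy ?_
    have he := Real.add_one_le_exp (2 * (4 * a ^ 2 + a))
    nlinarith [mul_le_mul_of_nonneg_left he hy.le, sq_nonneg a,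
      mul_nonneg (sq_nonneg a) (by linarith : (0 : ℝ) ≤ 1 - 4 * a)]
  calc Real.exp (-a) * (Real.sqrt (1 - 2 * a))⁻¹ ≤ Real.exp (-a) * Real.exp (4 * a ^ 2 + a) :=
        mul_le_mul_of_nonneg_left h1 (Real.exp_pos _).le
    _ = Real.exp (4 * a ^ 2) := by
        rw [← Real.exp_add]
        congr 1
        ring

/-- Off-diagonal constant: for `|a| ≤ 1/4`, `(1 - a²)^{-1/2} ≤ exp(4a²)` (`(1 - a²)(1 + 8a²) ≥ 1`). -/
theorem entGa_inv_sqrt_one_sub_sq_le {a : ℝ} (ha : |a| ≤ 1 / 4) :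
    (Real.sqrt (1 - a ^ 2))⁻¹ ≤ Real.exp (4 * a ^ 2) := by
  obtain ⟨ha1, ha2⟩ := abs_le.1 ha
  have hsq : a ^ 2 ≤ 1 / 16 := by nlinarith
  have hy : 0 < 1 - a ^ 2 := by linarith
  refine entGa_inv_sqrt_le_exp hy ?_
  have he := Real.add_one_le_exp (2 * (4 * a ^ 2))
  nlinarith [mul_le_mul_of_nonneg_left he hy.le, sq_nonneg a,
    mul_nonneg (sq_nonneg a) (by linarith : (0 : ℝ) ≤ 7 - 8 * a ^ 2)]

/-! ### Coordinates of the standard Gaussian of `ℝ³`: laws and exponential moments -/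

/-- The law of one coordinate of the standard Gaussian of `ℝ³` is `N(0,1)` (`γ = (⊗₃ N(0,1)).map toLp`,
`map_pi_eq_stdGaussian`, and the coordinate marginal of a product, `measurePreserving_eval`). [folklore] -/
theorem entGa_map_coord_stdGaussian (k : Fin 3) :
    (stdGaussian V3).map (fun w : V3 => w k) = gaussianReal 0 1 := by
  rw [← map_pi_eq_stdGaussian, Measure.map_map (by fun_prop) (by fun_prop)]
  exact (measurePreserving_eval (fun _ : Fin 3 => gaussianReal 0 1) k).map_eq

/-- The law of a pair of distinct coordinates of the standard Gaussian of `ℝ³` is `N(0,1) ⊗ N(0,1)`: the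
coordinates of the product measure `⊗₃ N(0,1)` are independent (`iIndepFun_pi`), and independence is the
product form of the joint law (`indepFun_iff_map_prod_eq_prod_map_map`). [folklore] -/
theorem entGa_map_pair_stdGaussian {i j : Fin 3} (hij : i ≠ j) :
    (stdGaussian V3).map (fun w : V3 => (w i, w j)) = (gaussianReal 0 1).prod (gaussianReal 0 1) := by
  rw [← map_pi_eq_stdGaussian, Measure.map_map (by fun_prop) (by fun_prop)]
  have hind : iIndepFun (fun k (x : Fin 3 → ℝ) => x k) (Measure.pi fun _ : Fin 3 => gaussianReal 0 1) :=
    iIndepFun_pi (X := fun _ x => x) fun _ => aemeasurable_id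
  have h2 := (indepFun_iff_map_prod_eq_prod_map_map (measurable_pi_apply i).aemeasurable
    (measurable_pi_apply j).aemeasurable).1 (hind.indepFun hij)
  have hi : (Measure.pi fun _ : Fin 3 => gaussianReal 0 1).map (fun x => x i) = gaussianReal 0 1 :=
    (measurePreserving_eval (fun _ : Fin 3 => gaussianReal 0 1) i).map_eq
  have hj : (Measure.pi fun _ : Fin 3 => gaussianReal 0 1).map (fun x => x j) = gaussianReal 0 1 :=
    (measurePreserving_eval (fun _ : Fin 3 => gaussianReal 0 1) j).map_eq
  rw [hi, hj] at h2
  exact h2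

/-- Exponential moment of a coordinate of the standard Gaussian of `ℝ³`: `∫ exp(t w_k) dγ = exp(t²/2)`.
[folklore] -/
theorem entGa_lintegral_exp_mul_coord_stdGaussian (k : Fin 3) (t : ℝ) :
    ∫⁻ w, ENNReal.ofReal (Real.exp (t * w k)) ∂(stdGaussian V3) = ENNReal.ofReal (Real.exp (t ^ 2 / 2)) := by
  rw [← lintegral_exp_mul_gaussianReal t, ← entGa_map_coord_stdGaussian k,
    lintegral_map (by fun_prop) (by fun_prop)]

/-- `χ²` exponential moment of a coordinate of the standard Gaussian of `ℝ³`: for `c < 1/2`,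
`∫ exp(c w_k²) dγ = (1 - 2c)^{-1/2}` (the one-dimensional `lintegral_exp_mul_sq_gaussianReal`, square-root form).
[folklore] -/
theorem entGa_lintegral_exp_mul_sq_coord_stdGaussian (k : Fin 3) {c : ℝ} (hc : c < 1 / 2) :
    ∫⁻ w, ENNReal.ofReal (Real.exp (c * w k ^ 2)) ∂(stdGaussian V3) =
      ENNReal.ofReal ((Real.sqrt (1 - 2 * c))⁻¹) := by
  have h1 := lintegral_exp_mul_sq_gaussianReal (a := c) (by linarith)
  rw [Real.rpow_neg (by linarith : (0 : ℝ) ≤ 1 - 2 * c), ← Real.sqrt_eq_rpow] at h1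
  rw [← h1, ← entGa_map_coord_stdGaussian k, lintegral_map (by fun_prop) (by fun_prop)]

/-- Exponential moment of a product of two distinct coordinates of the standard Gaussian of `ℝ³`: for `a² < 1`
and `i ≠ j`, `∫ exp(a w_i w_j) dγ = (1 - a²)^{-1/2}` (Tonelli over the independent pair, the `N(0,1)` mgf in `w_j`,
then the `χ²` moment `∫ exp(a² x²/2) N(0,1)(dx)`). [folklore] -/
theorem entGa_lintegral_exp_mul_prod_coord_stdGaussian {i j : Fin 3} (hij : i ≠ j) {a : ℝ} (ha : a ^ 2 < 1) :
    ∫⁻ w, ENNReal.ofReal (Real.exp (a * (w i * w j))) ∂(stdGaussian V3) =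
      ENNReal.ofReal ((Real.sqrt (1 - a ^ 2))⁻¹) := by
  have hmeas : Measurable fun p : ℝ × ℝ => ENNReal.ofReal (Real.exp (a * (p.1 * p.2))) := by fun_prop
  have hmp : MeasurePreserving (fun w : V3 => (w i, w j)) (stdGaussian V3)
      ((gaussianReal 0 1).prod (gaussianReal 0 1)) := ⟨by fun_prop, entGa_map_pair_stdGaussian hij⟩
  calc ∫⁻ w, ENNReal.ofReal (Real.exp (a * (w i * w j))) ∂(stdGaussian V3)
      = ∫⁻ p, ENNReal.ofReal (Real.exp (a * (p.1 * p.2))) ∂((gaussianReal 0 1).prod (gaussianReal 0 1)) :=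
        hmp.lintegral_comp hmeas
    _ = ∫⁻ x, ∫⁻ y, ENNReal.ofReal (Real.exp (a * (x * y))) ∂(gaussianReal 0 1) ∂(gaussianReal 0 1) :=
        lintegral_prod _ hmeas.aemeasurable
    _ = ∫⁻ x, ENNReal.ofReal (Real.exp (a ^ 2 / 2 * x ^ 2)) ∂(gaussianReal 0 1) := by
        refine lintegral_congr fun x => ?_
        have h := lintegral_exp_mul_gaussianReal (a * x)
        simp_rw [mul_assoc] at h
        rw [h, show (a * x) ^ 2 / 2 = a ^ 2 / 2 * x ^ 2 by ring]
    _ = ENNReal.ofReal ((Real.sqrt (1 - a ^ 2))⁻¹) := by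
        have h1 := lintegral_exp_mul_sq_gaussianReal (a := a ^ 2 / 2) (by linarith)
        rw [Real.rpow_neg (by linarith : (0 : ℝ) ≤ 1 - 2 * (a ^ 2 / 2)), ← Real.sqrt_eq_rpow,
          show 1 - 2 * (a ^ 2 / 2) = 1 - a ^ 2 by ring] at h1
        exact h1

/-! ### Transfer to the Maxwellian `N(u, θ𝟙)` and the registered sub-goal -/

/-- `lintegral` transfer: integration against `N(u, θ𝟙) = gaussMeasure u θ` is integration of `f (u + √θ w)`
against the standard Gaussian (`θ > 0`; the `ℝ≥0∞` form of `integral_gaussMeasure`). [folklore] -/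
theorem entGa_lintegral_gaussMeasure_eq (u : V3) {θ : ℝ} (hθ : 0 < θ) (f : V3 → ℝ≥0∞) :
    ∫⁻ v, f v ∂(gaussMeasure u θ) = ∫⁻ w, f (u + Real.sqrt θ • w) ∂(stdGaussian V3) := by
  rw [gaussMeasure, ← coe_gaussShiftEquiv u hθ, lintegral_map_equiv]
  rfl

/-- **Linear one-site moment** (second conjunct of Ga, with equality): for `θ > 0`,
`∫ exp(s (v_k - u_k)) N(u, θ𝟙)(dv) = exp(θ s²/2)`. [folklore] -/
theorem entGa_lintegral_exp_lin_gaussMeasure (u : V3) {θ : ℝ} (hθ : 0 < θ) (k : Fin 3) (s : ℝ) :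
    ∫⁻ w, ENNReal.ofReal (Real.exp (s * (w k - u k))) ∂(gaussMeasure u θ) =
      ENNReal.ofReal (Real.exp (θ * s ^ 2 / 2)) := by
  rw [entGa_lintegral_gaussMeasure_eq u hθ]
  have hfun : (fun w : V3 => ENNReal.ofReal (Real.exp (s * ((u + Real.sqrt θ • w) k - u k)))) =
      fun w => ENNReal.ofReal (Real.exp ((s * Real.sqrt θ) * w k)) := by
    funext w
    simp only [PiLp.add_apply, PiLp.smul_apply, smul_eq_mul, add_sub_cancel_left, mul_assoc]
  rw [hfun, entGa_lintegral_exp_mul_coord_stdGaussian k (s * Real.sqrt θ),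
    show (s * Real.sqrt θ) ^ 2 / 2 = θ * s ^ 2 / 2 by rw [mul_pow, Real.sq_sqrt hθ.le]; ring]

/-- **Diagonal one-site moment**: for `θ > 0` and `|s| θ ≤ 1/4`,
`∫ exp(s ((v_i - u_i)² - θ)) N(u, θ𝟙)(dv) ≤ exp(4 θ² s²)` (exact value `e^{-sθ}(1 - 2sθ)^{-1/2}`). [folklore] -/
theorem entGa_lintegral_exp_diag_gaussMeasure_le (u : V3) {θ : ℝ} (hθ : 0 < θ) (i : Fin 3) {s : ℝ}
    (hs : |s| * θ ≤ 1 / 4) :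
    ∫⁻ w, ENNReal.ofReal (Real.exp (s * ((w i - u i) * (w i - u i) - θ))) ∂(gaussMeasure u θ) ≤
      ENNReal.ofReal (Real.exp (4 * θ ^ 2 * s ^ 2)) := by
  have ha : |s * θ| ≤ 1 / 4 := by rwa [abs_mul, abs_of_pos hθ]
  have hc : s * θ < 1 / 2 := by linarith [(abs_le.1 ha).2]
  rw [entGa_lintegral_gaussMeasure_eq u hθ]
  have hfun : (fun w : V3 => ENNReal.ofReal (Real.exp
      (s * (((u + Real.sqrt θ • w) i - u i) * ((u + Real.sqrt θ • w) i - u i) - θ)))) =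
      fun w => ENNReal.ofReal (Real.exp (-(s * θ))) * ENNReal.ofReal (Real.exp ((s * θ) * w i ^ 2)) := by
    funext w
    rw [← ENNReal.ofReal_mul (Real.exp_pos _).le, ← Real.exp_add]
    simp only [PiLp.add_apply, PiLp.smul_apply, smul_eq_mul, add_sub_cancel_left]
    congr 2
    linear_combination (s * w i ^ 2) * Real.mul_self_sqrt hθ.le
  rw [hfun, lintegral_const_mul _ (by fun_prop), entGa_lintegral_exp_mul_sq_coord_stdGaussian i hc,
    ← ENNReal.ofReal_mul (Real.exp_pos _).le]
  refine ENNReal.ofReal_le_ofReal ?_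
  rw [show 4 * θ ^ 2 * s ^ 2 = 4 * (s * θ) ^ 2 by ring]
  exact entGa_exp_neg_mul_inv_sqrt_le ha

/-- **Off-diagonal one-site moment**: for `θ > 0`, `i ≠ j` and `|s| θ ≤ 1/4`,
`∫ exp(s (v_i - u_i)(v_j - u_j)) N(u, θ𝟙)(dv) ≤ exp(4 θ² s²)` (exact value `(1 - s²θ²)^{-1/2}`). [folklore] -/
theorem entGa_lintegral_exp_offdiag_gaussMeasure_le (u : V3) {θ : ℝ} (hθ : 0 < θ) {i j : Fin 3} (hij : i ≠ j)
    {s : ℝ} (hs : |s| * θ ≤ 1 / 4) :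
    ∫⁻ w, ENNReal.ofReal (Real.exp (s * ((w i - u i) * (w j - u j) - 0))) ∂(gaussMeasure u θ) ≤
      ENNReal.ofReal (Real.exp (4 * θ ^ 2 * s ^ 2)) := by
  have ha : |s * θ| ≤ 1 / 4 := by rwa [abs_mul, abs_of_pos hθ]
  have ha2 : (s * θ) ^ 2 < 1 := by
    obtain ⟨h1, h2⟩ := abs_le.1 ha
    nlinarith
  rw [entGa_lintegral_gaussMeasure_eq u hθ]
  have hfun : (fun w : V3 => ENNReal.ofReal (Real.exp
      (s * (((u + Real.sqrt θ • w) i - u i) * ((u + Real.sqrt θ • w) j - u j) - 0)))) =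
      fun w => ENNReal.ofReal (Real.exp ((s * θ) * (w i * w j))) := by
    funext w
    simp only [PiLp.add_apply, PiLp.smul_apply, smul_eq_mul, add_sub_cancel_left, sub_zero]
    congr 2
    linear_combination (s * (w i * w j)) * Real.mul_self_sqrt hθ.le
  rw [hfun, entGa_lintegral_exp_mul_prod_coord_stdGaussian hij ha2]
  refine ENNReal.ofReal_le_ofReal ?_
  rw [show 4 * θ ^ 2 * s ^ 2 = 4 * (s * θ) ^ 2 by ring]
  exact entGa_inv_sqrt_one_sub_sq_le ha

/-- **Ga: one-site Gaussian exponential moments (centred quadratic and linear).** Under the Maxwellian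
`N(u, θ𝟙) = gaussMeasure u θ` (`θ > 0`): (i) for `|s| θ ≤ 1/4` and all `i, j`,
`∫ exp(s ((v_i - u_i)(v_j - u_j) - θ δ_ij)) N(u, θ𝟙)(dv) ≤ exp(4 θ² s²)` (diagonal: `χ²` moment
`e^{-sθ}(1 - 2sθ)^{-1/2}`; off-diagonal: independent coordinates, `(1 - s²θ²)^{-1/2}`); (ii) for all `s`,
`∫ exp(s (v_k - u_k)) N(u, θ𝟙)(dv) ≤ exp(θ s²/2)` (with equality: the Gaussian mgf). [folklore] -/
theorem gauss_lintegral_exp_quad_le : (∀ (u : V3) (θ : ℝ), 0 < θ → ∀ (i j : Fin 3) (s : ℝ), |s| * θ ≤ 1 / 4 → ∫⁻ w, ENNReal.ofReal (Real.exp (s * ((w i - u i) * (w j - u j) - if i = j then θ else 0))) ∂(gaussMeasure u θ) ≤ ENNReal.ofReal (Real.exp (4 * θ ^ 2 * s ^ 2))) ∧ (∀ (u : V3) (θ : ℝ), 0 < θ → ∀ (k : Fin 3) (s : ℝ), ∫⁻ w, ENNReal.ofReal (Real.exp (s * (w k - u k))) ∂(gaussMeasure u θ) ≤ ENNReal.ofReal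 (Real.exp (θ * s ^ 2 / 2))) := by
  refine ⟨fun u θ hθ i j s hs => ?_, fun u θ hθ k s => (entGa_lintegral_exp_lin_gaussMeasure u hθ k s).le⟩
  rcases eq_or_ne i j with rfl | hij
  · rw [if_pos rfl]
    exact entGa_lintegral_exp_diag_gaussMeasure_le u hθ i hs
  · rw [if_neg hij]
    exact entGa_lintegral_exp_offdiag_gaussMeasure_le u hθ hij hs

end FluxClosureEnt
end Summit.AtomisticToContinuum.HydrodynamicLimit.Theorems

end
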